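import Literature.Computability.AlgebraicComplexity.FlipGraph222OrbitCanon
import Literature.Computability.AlgebraicComplexity.FlipGraph222StdComponent
import HarnessLib

/-!
# The component of the standard algorithm has exactly `273` vertices — key replay 1/3 (`(2,2,2)`, `ℤ₂`; KM 2023 §4)

Topic `Literature/Computability/AlgebraicComplexity`. Source: M. Kauers, J. Moosbauer, *Flip Graphs
for Matrix Multiplication*, ISSAC 2023 = arXiv:2212.01175 (KM), §4 / Fig. 1: the connected component
of the standard algorithm in the `(2,2,2)`-flip graph of rank at most `8` over `ℤ₂` "has `272`
vertices, each representing the orbit of one multiplication scheme".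

## What is typed (everything PROVED, kernel replay; no definitions, no named facts)

`FlipGraph222StdComponent.lean` lists `273` code lists `Comp222.creps` whose orbits ARE the component
of the standard algorithm (`Comp222.kauersMoosbauer2023_fig1_component_eq`), and
`FlipGraph222OrbitCanon.lean` provides a `G`-invariant key `Canon222.canonKey` of well-formed code
lists together with the table `Canon222.canonTab` of the `273` keys reduced modulo the prime
`Canon222.keyMod = 2⁶¹ − 1`, pairwise distinct (`Canon222.canonTab_nodup`). This file replays, in the kernel,
`canonKey creps[i] % keyMod = canonTab[i]` for the representatives `0 ≤ i < 96` (chunks of `6`,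
`decide +kernel`); the sibling files cover the other indices, and
`FlipGraph222StdComponentCanon3.lean` concludes: the `273` listed orbits are pairwise distinct
(`Comp222.cv_injective`), so the component has EXACTLY `273` vertices
(`Comp222.kauersMoosbauer2023_fig1_component_card`; KM print `272`).

## References

* M. Kauers, J. Moosbauer, *Flip Graphs for Matrix Multiplication*, ISSAC 2023, 381–388,
  doi:10.1145/3597066.3597120, arXiv:2212.01175: §2 (equivalence = same orbit), Def. 8, Thm. 9,
  §4 and Fig. 1 ("It has 272 vertices"). [KauersMoosbauer2022FlipGraphs]
-/

set_option Elab.async false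

namespace Literature.Computability.AlgebraicComplexity

namespace FlipGraph

namespace Comp222

open Cert222 StdBall222 Hidden222 Canon222

/-- Key replay, chunk 0 (representatives `0 ≤ i < 6`): the canonical key of `creps[i]`,
reduced modulo `keyMod`, is `canonTab[i]` (kernel evaluation). [cite: KauersMoosbauer2022FlipGraphs, §4 ("It has 272 vertices"), §2 (equivalence = same orbit)] -/
theorem canonOk_0 : ((List.range' 0 6).all fun i =>
    canonKey (creps.getD i []) % keyMod == canonTab.getD i 0) = true := by
  decide +kernel

/-- Key replay, chunk 1 (representatives `6 ≤ i < 12`): the canonical key of `creps[i]`,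
reduced modulo `keyMod`, is `canonTab[i]` (kernel evaluation). [cite: KauersMoosbauer2022FlipGraphs, §4 ("It has 272 vertices"), §2 (equivalence = same orbit)] -/
theorem canonOk_1 : ((List.range' 6 6).all fun i =>
    canonKey (creps.getD i []) % keyMod == canonTab.getD i 0) = true := by
  decide +kernel

/-- Key replay, chunk 2 (representatives `12 ≤ i < 18`): the canonical key of `creps[i]`,
reduced modulo `keyMod`, is `canonTab[i]` (kernel evaluation). [cite: KauersMoosbauer2022FlipGraphs, §4 ("It has 272 vertices"), §2 (equivalence = same orbit)] -/
theorem canonOk_2 : ((List.range' 12 6).all fun i =>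
    canonKey (creps.getD i []) % keyMod == canonTab.getD i 0) = true := by
  decide +kernel

/-- Key replay, chunk 3 (representatives `18 ≤ i < 24`): the canonical key of `creps[i]`,
reduced modulo `keyMod`, is `canonTab[i]` (kernel evaluation). [cite: KauersMoosbauer2022FlipGraphs, §4 ("It has 272 vertices"), §2 (equivalence = same orbit)] -/
theorem canonOk_3 : ((List.range' 18 6).all fun i =>
    canonKey (creps.getD i []) % keyMod == canonTab.getD i 0) = true := by
  decide +kernel

/-- Key replay, chunk 4 (representatives `24 ≤ i < 30`): the canonical key of `creps[i]`,
reduced modulo `keyMod`, is `canonTab[i]` (kernel evaluation). [cite: KauersMoosbauer2022FlipGraphs, §4 ("It has 272 vertices"), §2 (equivalence = same orbit)] -/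
theorem canonOk_4 : ((List.range' 24 6).all fun i =>
    canonKey (creps.getD i []) % keyMod == canonTab.getD i 0) = true := by
  decide +kernel

/-- Key replay, chunk 5 (representatives `30 ≤ i < 36`): the canonical key of `creps[i]`,
reduced modulo `keyMod`, is `canonTab[i]` (kernel evaluation). [cite: KauersMoosbauer2022FlipGraphs, §4 ("It has 272 vertices"), §2 (equivalence = same orbit)] -/
theorem canonOk_5 : ((List.range' 30 6).all fun i =>
    canonKey (creps.getD i []) % keyMod == canonTab.getD i 0) = true := by
  decide +kernel

/-- Key replay, chunk 6 (representatives `36 ≤ i < 42`): the canonical key of `creps[i]`,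
reduced modulo `keyMod`, is `canonTab[i]` (kernel evaluation). [cite: KauersMoosbauer2022FlipGraphs, §4 ("It has 272 vertices"), §2 (equivalence = same orbit)] -/
theorem canonOk_6 : ((List.range' 36 6).all fun i =>
    canonKey (creps.getD i []) % keyMod == canonTab.getD i 0) = true := by
  decide +kernel

/-- Key replay, chunk 7 (representatives `42 ≤ i < 48`): the canonical key of `creps[i]`,
reduced modulo `keyMod`, is `canonTab[i]` (kernel evaluation). [cite: KauersMoosbauer2022FlipGraphs, §4 ("It has 272 vertices"), §2 (equivalence = same orbit)] -/
theorem canonOk_7 : ((List.range' 42 6).all fun i =>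
    canonKey (creps.getD i []) % keyMod == canonTab.getD i 0) = true := by
  decide +kernel

/-- Key replay, chunk 8 (representatives `48 ≤ i < 54`): the canonical key of `creps[i]`,
reduced modulo `keyMod`, is `canonTab[i]` (kernel evaluation). [cite: KauersMoosbauer2022FlipGraphs, §4 ("It has 272 vertices"), §2 (equivalence = same orbit)] -/
theorem canonOk_8 : ((List.range' 48 6).all fun i =>
    canonKey (creps.getD i []) % keyMod == canonTab.getD i 0) = true := by
  decide +kernel

/-- Key replay, chunk 9 (representatives `54 ≤ i < 60`): the canonical key of `creps[i]`,
reduced modulo `keyMod`, is `canonTab[i]` (kernel evaluation). [cite: KauersMoosbauer2022FlipGraphs, §4 ("It has 272 vertices"), §2 (equivalence = same orbit)] -/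
theorem canonOk_9 : ((List.range' 54 6).all fun i =>
    canonKey (creps.getD i []) % keyMod == canonTab.getD i 0) = true := by
  decide +kernel

/-- Key replay, chunk 10 (representatives `60 ≤ i < 66`): the canonical key of `creps[i]`,
reduced modulo `keyMod`, is `canonTab[i]` (kernel evaluation). [cite: KauersMoosbauer2022FlipGraphs, §4 ("It has 272 vertices"), §2 (equivalence = same orbit)] -/
theorem canonOk_10 : ((List.range' 60 6).all fun i =>
    canonKey (creps.getD i []) % keyMod == canonTab.getD i 0) = true := by
  decide +kernel

/-- Key replay, chunk 11 (representatives `66 ≤ i < 72`): the canonical key of `creps[i]`,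
reduced modulo `keyMod`, is `canonTab[i]` (kernel evaluation). [cite: KauersMoosbauer2022FlipGraphs, §4 ("It has 272 vertices"), §2 (equivalence = same orbit)] -/
theorem canonOk_11 : ((List.range' 66 6).all fun i =>
    canonKey (creps.getD i []) % keyMod == canonTab.getD i 0) = true := by
  decide +kernel

/-- Key replay, chunk 12 (representatives `72 ≤ i < 78`): the canonical key of `creps[i]`,
reduced modulo `keyMod`, is `canonTab[i]` (kernel evaluation). [cite: KauersMoosbauer2022FlipGraphs, §4 ("It has 272 vertices"), §2 (equivalence = same orbit)] -/
theorem canonOk_12 : ((List.range' 72 6).all fun i =>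
    canonKey (creps.getD i []) % keyMod == canonTab.getD i 0) = true := by
  decide +kernel

/-- Key replay, chunk 13 (representatives `78 ≤ i < 84`): the canonical key of `creps[i]`,
reduced modulo `keyMod`, is `canonTab[i]` (kernel evaluation). [cite: KauersMoosbauer2022FlipGraphs, §4 ("It has 272 vertices"), §2 (equivalence = same orbit)] -/
theorem canonOk_13 : ((List.range' 78 6).all fun i =>
    canonKey (creps.getD i []) % keyMod == canonTab.getD i 0) = true := by
  decide +kernel

/-- Key replay, chunk 14 (representatives `84 ≤ i < 90`): the canonical key of `creps[i]`,
reduced modulo `keyMod`, is `canonTab[i]` (kernel evaluation). [cite: KauersMoosbauer2022FlipGraphs, §4 ("It has 272 vertices"), §2 (equivalence = same orbit)] -/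
theorem canonOk_14 : ((List.range' 84 6).all fun i =>
    canonKey (creps.getD i []) % keyMod == canonTab.getD i 0) = true := by
  decide +kernel

/-- Key replay, chunk 15 (representatives `90 ≤ i < 96`): the canonical key of `creps[i]`,
reduced modulo `keyMod`, is `canonTab[i]` (kernel evaluation). [cite: KauersMoosbauer2022FlipGraphs, §4 ("It has 272 vertices"), §2 (equivalence = same orbit)] -/
theorem canonOk_15 : ((List.range' 90 6).all fun i =>
    canonKey (creps.getD i []) % keyMod == canonTab.getD i 0) = true := by
  decide +kernel

end Comp222

end FlipGraph

end Literature.Computability.AlgebraicComplexity
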